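import Mathlib.Analysis.SpecialFunctions.SmoothTransition
import Mathlib.Analysis.SpecialFunctions.ExpDeriv
import Mathlib.Analysis.Complex.Basic

/-!
# BalabanUVNodes ∕ node N22 = NE9 — A6 WITNESS FOR THE SECTOR DATUM OF MODULE J46: the possibility-1 signature `z² e^{−1∕z}` MEETS the sector clause (relative discs
# `closedBall s (s∕2)`, centred quadratic bound `(9∕4)s²`) while its real trace is Mathlib's `C^∞`-but-flat glue `t² · expNegInvGlue t` — the shape the uniform-disc clause excludes

Cell `pub-ymgap`, HUMAN RULING D-0062 (Track A), R134 seat `pub-ymgap-dag-n22-c` (strategy s1), generation 15, module J47 (honesty rider to J45∕J46).  THEOREMS ONLY (no `def`,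
no `sorry`, standard axioms); Mathlib only.  `--kind proof --supports stmt-QuantumFields-27366 --as helper`, COUNT-NEUTRAL.

WHY.  Module J46 §3 (`ne9_EA_objectsOfRecord₁₃_of_kernelStepRate_sectorHolo`) keys the last (and every) young coupling on the SECTOR datum: a holomorphic extension on a set
containing the relative closed discs `closedBall s (c·s)`, `s ∈ ]0, γ]`, with `‖Ec z − V‖ ≤ B·s²` there.  This lane's g6 rider 26′ showed that the UNIFORM-disc clause it replaces
(`closedBall t r ⊆ U` for all `t ∈ [0, γ]`, hence `ball 0 r ⊆ U`) forces analyticity AT zero coupling and freezes any real threshold law — the possibility-2 type of [I] p. 266.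
THIS FILE certifies that the sector clause does NOT: the function `f z = z²·e^{−1∕z}` — holomorphic on the open right half-plane, `|e^{−1∕z}| ≤ 1` there, flat at `0` along the
reals — satisfies J46's sector datum with `c = 1∕2`, `B = 9∕4`, `V = 0` on EVERY window `]0, γ]` (§2), and its real trace is `t² · expNegInvGlue t` (§3), Mathlib's smooth,
non-analytic-at-zero glue: print's possibility-1 sentence «a C^∞-function of g_{j−1} ∈ [0, γ]» ([I] p. 263) made concrete, with the `e^{−1∕g}`-type flatness of the
small-field thresholds `ε₁∕g` ([I] (2.9) p. 266, (2.12)–(2.13) p. 268).  So J46's binder is inhabited by a coupling-SENSITIVE, non-entire datum — the opposite of 26′'s verdict on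
the uniform-disc clause.  (That `f` admits no holomorphic extension to any disc about `0` is the classical essential singularity of `e^{−1∕z}`; not re-proved here.)
* §1 `re_pos_of_mem_sectorDisc` (on `closedBall s (s∕2)`, `s > 0`: `Re z ≥ s∕2 > 0` and `‖z‖ ≤ 3s∕2`), `norm_cexp_neg_inv_le_one` (`Re z > 0 ⇒ ‖e^{−1∕z}‖ ≤ 1`).
* §2 ★ `sectorDatum_sq_mul_cexp_neg_inv` — J46 §3's `hLsec` clause shape for `f`, at `O := {z | 0 < z.re}`, `c := 1∕2`, `B := 9∕4`, `V := 0`, every `γ`.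
* §3 `realTrace_sq_mul_cexp_neg_inv` (`f t = t²·expNegInvGlue t` for `t > 0`) and `contDiff_realTrace` (the trace `t ↦ t²·expNegInvGlue t` is `C^∞` on `ℝ`).

HONEST FRAMING.  A Mathlib-only model witness for a HYPOTHESIS SHAPE; nothing of Bałaban's asserted; it says nothing about the record's actual terms; N22 NOT discharged
(typed 28∕28 · discharged 5∕27 UNCHANGED); K3⁸ OPEN; NE9 NOT IN PRINT for d = 4; nothing continuum ∕ ℝ⁴ ∕ OS ∕ mass gap ∕ Clay.  References (TYPES and page anchors only):
[I] = Bałaban, CMP 109 (1987) §1 p. 263, (2.9) p. 266, (2.12)–(2.13) p. 268.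
-/

noncomputable section

open Set Metric Complex

namespace YMDAG.N22.KernelFading.SectorWitness

/-! ## §1 Geometry of the relative discs and the half-plane bound on `e^{−1∕z}` -/

/-- On the relative closed disc `closedBall s (s∕2)` about a window coupling `s > 0`: `Re z ≥ s∕2` (so `Re z > 0`) and `‖z‖ ≤ 3s∕2`. [folklore] -/
theorem re_pos_of_mem_sectorDisc {s : ℝ} (hs : 0 < s) {z : ℂ} (hz : z ∈ closedBall (s : ℂ) (1 / 2 * s)) :
    s / 2 ≤ z.re ∧ 0 < z.re ∧ ‖z‖ ≤ 3 / 2 * s := by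
  rw [mem_closedBall, dist_eq_norm] at hz
  have hre : |z.re - s| ≤ 1 / 2 * s := by
    have h := abs_re_le_norm (z - (s : ℂ))
    rw [sub_re, ofReal_re] at h
    exact h.trans hz
  have h1 : s / 2 ≤ z.re := by
    have := (abs_le.mp hre).1
    linarith
  refine ⟨h1, by linarith, ?_⟩
  calc ‖z‖ = ‖(z - (s : ℂ)) + (s : ℂ)‖ := by rw [sub_add_cancel]
    _ ≤ ‖z - (s : ℂ)‖ + ‖(s : ℂ)‖ := norm_add_le _ _
    _ ≤ 1 / 2 * s + s := by
        gcongr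
        rw [norm_real, Real.norm_eq_abs, abs_of_pos hs]
    _ = 3 / 2 * s := by ring

/-- On the open right half-plane `|e^{−1∕z}| = e^{−Re z ∕ |z|²} ≤ 1`. [folklore] -/
theorem norm_cexp_neg_inv_le_one {z : ℂ} (hz : 0 < z.re) : ‖cexp (-z⁻¹)‖ ≤ 1 := by
  rw [norm_exp, Real.exp_le_one_iff, neg_re, inv_re, neg_nonpos]
  exact div_nonneg hz.le (normSq_nonneg z)

/-! ## §2 ★ The sector datum of module J46 §3 is met by `z² e^{−1∕z}` -/

/-- ★ **THE SECTOR CLAUSE IS INHABITED BY A COUPLING-SENSITIVE, NON-ENTIRE DATUM.**  For every window `γ`: with `O := {z | 0 < Re z}`, `c := 1∕2`, `B := 9∕4`, `V := 0`, the function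
`f z := z²·e^{−1∕z}` is holomorphic on `O`, every relative disc `closedBall s (s∕2)` (`s ∈ ]0, γ]`) lies in `O`, and `‖f z − 0‖ ≤ (9∕4)·s²` on it — exactly the three analytic
conjuncts of J46 §3's `hLsec` (the fourth, the trace clause, names the term of record and is not modelled).  Contrast 26′: the uniform-disc clause would force analyticity at `0`.
[folklore] -/
theorem sectorDatum_sq_mul_cexp_neg_inv (γ : ℝ) :
    ∃ (Ec : ℂ → ℂ) (O : Set ℂ) (V : ℂ), (∀ z, Ec z = z ^ 2 * cexp (-z⁻¹)) ∧ V = 0 ∧ DifferentiableOn ℂ Ec O ∧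
      (∀ s ∈ Ioc (0 : ℝ) γ, closedBall (s : ℂ) (1 / 2 * s) ⊆ O) ∧
      (∀ s ∈ Ioc (0 : ℝ) γ, ∀ z ∈ closedBall (s : ℂ) (1 / 2 * s), ‖Ec z - V‖ ≤ 9 / 4 * s ^ 2) := by
  refine ⟨fun z => z ^ 2 * cexp (-z⁻¹), {z | 0 < z.re}, 0, fun _ => rfl, rfl, ?_, ?_, ?_⟩
  · -- holomorphy on the right half-plane (`z ≠ 0` there)
    intro z hz
    have hz' : 0 < z.re := hz
    have hz0 : z ≠ 0 := by
      rintro rfl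
      simp at hz'
    exact (((differentiableAt_id.pow 2).mul ((differentiableAt_id.inv hz0).neg.cexp)).differentiableWithinAt)
  · intro s hs z hz
    exact (re_pos_of_mem_sectorDisc hs.1 hz).2.1
  · intro s hs z hz
    obtain ⟨-, hre, hnz⟩ := re_pos_of_mem_sectorDisc hs.1 hz
    rw [sub_zero, norm_mul, norm_pow]
    have h1 : ‖z‖ ^ 2 ≤ (3 / 2 * s) ^ 2 := pow_le_pow_left₀ (norm_nonneg _) hnz 2
    have h2 := norm_cexp_neg_inv_le_one hre
    calc ‖z‖ ^ 2 * ‖cexp (-z⁻¹)‖ ≤ (3 / 2 * s) ^ 2 * 1 := mul_le_mul h1 h2 (norm_nonneg _) (by positivity)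
      _ = 9 / 4 * s ^ 2 := by ring

/-! ## §3 The real trace is Mathlib's `C^∞`-but-flat glue: print's possibility-1 sentence made concrete -/

/-- On the positive reals the witness IS `t² · expNegInvGlue t` (Mathlib's `e^{−1∕t}` for `t > 0`, `0` for `t ≤ 0`). [folklore] -/
theorem realTrace_sq_mul_cexp_neg_inv {t : ℝ} (ht : 0 < t) :
    ((t : ℂ) ^ 2 * cexp (-(t : ℂ)⁻¹)) = (((t ^ 2 * expNegInvGlue t : ℝ)) : ℂ) := by
  have hglue : expNegInvGlue t = Real.exp (-t⁻¹) := by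
    simp [expNegInvGlue, not_le.mpr ht]
  rw [hglue]
  push_cast
  rfl

/-- The real trace `t ↦ t²·expNegInvGlue t` is `C^∞` on all of `ℝ` (flat at `0`: «a C^∞-function of g_{j−1} ∈ [0, γ]», [I] p. 263) — and, classically, NOT analytic at `0`
(essential singularity of `e^{−1∕z}`; not re-proved). [folklore] -/
theorem contDiff_realTrace {n : ℕ∞} : ContDiff ℝ n (fun t : ℝ => t ^ 2 * expNegInvGlue t) :=
  (contDiff_id.pow 2).mul expNegInvGlue.contDiff

end YMDAG.N22.KernelFading.SectorWitness

end
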